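import Summits.QuantumFields.YangMills.Theorems.CovariantDischargeDoorGlueLetters
import Summits.QuantumFields.YangMills.Theorems.CovariantDischargeDoorThresholdJ0
import HarnessLib

/-!
# Line «sandwich_discharge» on crux `HistoryTailL` (stmt-QuantumFields-19936), stub `stub_sandwichSweepGapCapped` (S′), B6 door leaf `hGLUE` —
# «THE GLUE ARITHMETIC»: the comb sweep's cost bracket `REST` (✓`CovariantDischargeCombSweepProfileGlue.profile_signal_sub_cost_le_wilsonAction4_sub_sweepInv`,
# w5 g14) in the profile socket's letters is `≤ s·θ∕16 + B_c·L^j·s²` past ONE depth threshold `j₀`, under the severity CAP and the threshold ratio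

Cell `ym3-torus` (YM ladder rung R3 = continuum SU(2) Yang–Mills on the three-torus — a RUNG, NOT the Clay problem: not d = 4, not infinite volume,
not a mass gap); WIDTH seat `ym3-torus-px8` gen 8 (the B6 door pen); `--supports stmt-QuantumFields-19936` (helper).  THEOREMS ONLY (0 `def`, default heartbeats).

WHY (DOOR SKELETON v4 d7538d1f, leaf `hGLUE : ∃ REST, REST ≤ s·θ∕16 + B_c·L^j·s² ∧ SIG − REST ≤ A(V) − A(Ψ′V)`).  The second conjunct is w5 g14's GLUE-KNIT with
`REST = ¾s²Q + θ_K·d·(sM_L)·(2(4τ + 4η + θ_K) + 176τ) + (3∕2)·d·(sM_L)·((8τ² + 2τ(4η + θ_K))·(2(4τ + 4η + θ_K)) + 30976τ³)`, `τ := s·A_T·4L^{2j}` ((T″)),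
`M_L := (A_L + A_L′(2R + 1 + 2L^h))·4L^{2j}` ((S″)), `Q := 328·8L^j + A_Q(24L^{2j}L^h)²∕(R−2)^5` ((Q″)), `η := ((2d(r+1)+2)²∕4)·θ_K` (lasso, `r = 2R + L^h`), `d = 3`,
`s := κθ∕(2B_cL^j)`, `κ = 1∕8`, `B_c := 3(2624 + 32·576·A_Q) + 1`, `R = N_R·L^(2j+h)`, `h = j + m`, `N_R ≥ 12`.  THIS FILE proves the first conjunct:
* §1 ★`exists_j0_glue` — ONE `j₀` past which the five GLUE rows hold (each an instance of ✓`CovariantDischargeDoorExponentRows.exists_forall_row_le`: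
  `Γ ∈ {151, 22801}`, `a ∈ {16, 11, 7, 26, 17}`, `Γ < 3^a`);
* §2 ★★`glue_rest_le` = the leaf's first conjunct PLUS the guard `τ ≤ 1∕4` (w5's `hsmall`), assembled from the letters ✓`CovariantDischargeDoorGlueLetters`
  (`m1_le` … `cQ_le`, `rest_abstract_le`) and the cores ✓`core_R3`∕✓`core_R5`;
* §3 the pairing-box lasso at the RE-CENTRED radius `r = 2R + L^h` (the comb gauge is centred at `c₀`, the profile's box at `C`, `‖C − c₀‖∞ < L^h`,
  ✓`exists_recentred`): `betaK_le` (`((2·3·r+2)²∕4)θ_K ≤ 49R²θ_K` for `4L^h + 4 ≤ R`) and `bulk_conjunct_le_of_le` = px7 g8's ✓`bulk_conjunct_le` ((S7) conjunct 4)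
  for ANY lasso constant `β ≤ 49R²θ_K` (the D6-MEANS guards `81ℓ(4ℓ)^kβ_k ≤ 1` are px18 g6's ✍`CovariantDischargeDoorGuardRows`, not restated here).
HONEST SCOPE: real arithmetic; NOTHING here proves the capped stub, `HistoryTailL`, or any summit statement; YM₃ on T³ is rung R3, not Clay. [folklore]
-/

noncomputable section

namespace Summit.QuantumFields.YangMills.Theorems.CovariantDischargeDoorGlueRows

open Summit.QuantumFields.YangMills.Theorems.CovariantDischargeDoorExponentRows
open Summit.QuantumFields.YangMills.Theorems.CovariantDischargeDoorThresholdJ0 (eventually_and bulk_row_le')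
open Summit.QuantumFields.YangMills.Theorems.CovariantDischargeDoorGlueLetters

/-! ## §1 One depth threshold for the five GLUE rows -/

/-- The extra numeric facts of record: `151 < 3^11`, `151 < 3^16`, `22801 < 3^26` (`151 < 3^7`, `22801 < 3^17` are ✓`gamma_facts`). [folklore] -/
theorem gamma_facts' : (151 : ℝ) < (3 : ℝ) ^ 11 ∧ (151 : ℝ) < (3 : ℝ) ^ 16 ∧ (22801 : ℝ) < (3 : ℝ) ^ 26 := by norm_num

/-- ★ **THE GLUE SLOT**: for `L ≥ 3` there is `j₀` such that for every `j > j₀` the five GLUE rows hold (guard `τ ≤ 1∕4`; the `θ_Kτ`, `θ_Kη + θ_K² + τθ_K²`,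
`τ³`, `τη²` monomials of the cost bracket, each normalised by `θ∕64`). [folklore] -/
theorem exists_j0_glue {L : ℕ} (hL : 3 ≤ L) (A_T A₁ N_R p₀ : ℝ) (m : ℕ) :
    ∃ j₀ : ℕ, ∀ j : ℕ, j₀ < j →
      A_T * (151 : ℝ) ^ j / (L : ℝ) ^ (16 * j) ≤ 1 ∧
      8832 * A_T * A₁ * (N_R * (2 : ℝ) ^ p₀ * (L : ℝ) ^ m) * (151 : ℝ) ^ j / (L : ℝ) ^ (11 * j) ≤ 1 ∧
      (75648 + 864 * A_T) * A₁ * (N_R ^ 3 * (4 : ℝ) ^ p₀ * (L : ℝ) ^ (3 * m)) * (151 : ℝ) ^ j / (L : ℝ) ^ (7 * j) ≤ 1 ∧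
      140256 * A₁ * A_T ^ 3 * (N_R * (L : ℝ) ^ m) * (22801 : ℝ) ^ j / (L : ℝ) ^ (26 * j) ≤ 1 ∧
      33191424 * A₁ * A_T * (N_R ^ 5 * (4 : ℝ) ^ p₀ * (L : ℝ) ^ (5 * m)) * (22801 : ℝ) ^ j / (L : ℝ) ^ (17 * j) ≤ 1 := by
  have h0 := exists_forall_row_le hL (by norm_num) gamma_facts'.2.1 A_T 1 one_pos
  have h1 := exists_forall_row_le hL (by norm_num) gamma_facts'.1 (8832 * A_T * A₁) (N_R * (2 : ℝ) ^ p₀ * (L : ℝ) ^ m) one_pos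
  have h2 := exists_forall_row_le hL (by norm_num) gamma_facts.1 ((75648 + 864 * A_T) * A₁)
    (N_R ^ 3 * (4 : ℝ) ^ p₀ * (L : ℝ) ^ (3 * m)) one_pos
  have h4 := exists_forall_row_le hL (by norm_num) gamma_facts'.2.2 (140256 * A₁ * A_T ^ 3) (N_R * (L : ℝ) ^ m) one_pos
  have h5 := exists_forall_row_le hL (by norm_num) gamma_facts.2.2 (33191424 * A₁ * A_T)
    (N_R ^ 5 * (4 : ℝ) ^ p₀ * (L : ℝ) ^ (5 * m)) one_pos
  obtain ⟨j₀, hj₀⟩ := eventually_and h0 (eventually_and h1 (eventually_and h2 (eventually_and h4 h5)))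
  refine ⟨j₀, fun j hj => ?_⟩
  obtain ⟨a0, a1, a2, a4, a5⟩ := hj₀ j hj
  refine ⟨?_, a1, a2, a4, a5⟩
  rw [mul_one] at a0
  exact a0

/-! ## §2 The GLUE arithmetic assembled -/

section Assembly

variable {L j m h r R N_R : ℕ} {θ θK x p₀ A_Q A_L A_L' A_T Bc s : ℝ}

/-- ★★ **THE GLUE ARITHMETIC** (leaf `hGLUE`, first conjunct, and w5's guard `hsmall`): in the socket's letters, under the CAP, the threshold ratio, `θ ≤ x ≤ 1`
and the five GLUE rows at depth `j`, `τ := s·A_T·4L^{2j} ≤ 1∕4` and `REST ≤ s·θ∕16 + B_c·L^j·s²`. [folklore] -/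
theorem glue_rest_le {d : ℕ} (hd : d = 3) (hL : 3 ≤ L) (hh : h = j + m) (hR : R = N_R * L ^ (2 * j + h)) (hNR : 12 ≤ N_R)
    (hr : r = 2 * R + L ^ h) (hθ : 0 ≤ θ) (hθx : θ ≤ x) (hx1 : x ≤ 1)
    (hx : x ≤ (151 * (L : ℝ) ^ 2 * ((L : ℝ)⁻¹) ^ 19) ^ j) (hθK0 : 0 ≤ θK)
    (hθK : θK ≤ (2 : ℝ) ^ p₀ * Real.sqrt ((L : ℝ)⁻¹) ^ j * θ)
    (hAQ : 0 ≤ A_Q) (hAL : 0 ≤ A_L) (hAL' : 0 ≤ A_L') (hAT : 0 ≤ A_T)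
    (hBc : Bc = 3 * (2624 + 32 * 576 * A_Q) + 1) (hs : s = 1 / 8 * θ / (2 * (Bc * (L : ℝ) ^ j)))
    (h0 : A_T * (151 : ℝ) ^ j / (L : ℝ) ^ (16 * j) ≤ 1)
    (h1 : 8832 * A_T * (4 * (A_L + 3 * A_L')) * ((N_R : ℝ) * (2 : ℝ) ^ p₀ * (L : ℝ) ^ m) * (151 : ℝ) ^ j / (L : ℝ) ^ (11 * j) ≤ 1)
    (h2 : (75648 + 864 * A_T) * (4 * (A_L + 3 * A_L')) * ((N_R : ℝ) ^ 3 * (4 : ℝ) ^ p₀ * (L : ℝ) ^ (3 * m)) * (151 : ℝ) ^ j /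
      (L : ℝ) ^ (7 * j) ≤ 1)
    (h4 : 140256 * (4 * (A_L + 3 * A_L')) * A_T ^ 3 * ((N_R : ℝ) * (L : ℝ) ^ m) * (22801 : ℝ) ^ j / (L : ℝ) ^ (26 * j) ≤ 1)
    (h5 : 33191424 * (4 * (A_L + 3 * A_L')) * A_T * ((N_R : ℝ) ^ 5 * (4 : ℝ) ^ p₀ * (L : ℝ) ^ (5 * m)) * (22801 : ℝ) ^ j /
      (L : ℝ) ^ (17 * j) ≤ 1) :
    s * (A_T * (4 * ((L : ℝ) ^ j) ^ 2)) ≤ 1 / 4 ∧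
    3 / 4 * s ^ 2 * (328 * (8 * (L : ℝ) ^ j) + A_Q * (24 * ((L : ℝ) ^ j) ^ 2 * (L : ℝ) ^ h) ^ 2 / ((R : ℝ) - 2) ^ 5) +
      θK * (d : ℝ) * (s * ((A_L + A_L' * (2 * (R : ℝ) + 1 + 2 * (L : ℝ) ^ h)) * (4 * ((L : ℝ) ^ j) ^ 2))) *
        (2 * (4 * (s * (A_T * (4 * ((L : ℝ) ^ j) ^ 2))) + 4 * ((((2 * d * (r + 1) + 2 : ℕ) : ℝ) ^ 2 / 4) * θK) + θK) +
          176 * (s * (A_T * (4 * ((L : ℝ) ^ j) ^ 2)))) +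
      3 / 2 * (d : ℝ) * (s * ((A_L + A_L' * (2 * (R : ℝ) + 1 + 2 * (L : ℝ) ^ h)) * (4 * ((L : ℝ) ^ j) ^ 2))) *
        ((8 * (s * (A_T * (4 * ((L : ℝ) ^ j) ^ 2))) ^ 2 +
            2 * (s * (A_T * (4 * ((L : ℝ) ^ j) ^ 2))) * (4 * ((((2 * d * (r + 1) + 2 : ℕ) : ℝ) ^ 2 / 4) * θK) + θK)) *
          (2 * (4 * (s * (A_T * (4 * ((L : ℝ) ^ j) ^ 2))) + 4 * ((((2 * d * (r + 1) + 2 : ℕ) : ℝ) ^ 2 / 4) * θK) + θK)) +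
          30976 * (s * (A_T * (4 * ((L : ℝ) ^ j) ^ 2))) ^ 3)
      ≤ s * θ / 16 + Bc * (L : ℝ) ^ j * s ^ 2 := by
  subst hd
  have hL1n : 1 ≤ L := le_trans (by norm_num) hL
  obtain ⟨hR12, hRh, hjR⟩ := radius_facts hL1n hR hNR
  have hL1 : (1 : ℝ) ≤ L := by exact_mod_cast hL1n
  have hL0 : (0 : ℝ) < L := by linarith
  have hR1 : (1 : ℝ) ≤ R := by exact_mod_cast (show 1 ≤ R by omega)
  have hR0 : (0 : ℝ) ≤ R := by linarith
  have hBc1 : 1 ≤ Bc := by rw [hBc]; nlinarith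
  have hBc0 : 0 < Bc := by linarith
  have hBc4 : (4 : ℝ) ≤ 4 * Bc := by linarith
  have hBQ : 2624 + 18432 * A_Q ≤ Bc / 3 := by
    rw [le_div_iff₀ (by norm_num : (0 : ℝ) < 3), hBc]; norm_num; nlinarith
  have hθ1 : θ ≤ 1 := hθx.trans hx1
  -- the cores and cap monomials (before any abbreviation)
  have hRr : (R : ℝ) = (N_R : ℝ) * (L : ℝ) ^ (2 * j + h) := by rw [hR]; push_cast; ring
  have hNR0 : (0 : ℝ) ≤ N_R := by positivity
  have hC3 := core_R3 hL1n hθ hθx hθK0 hθK hx hNR0 hh hRr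
  have hC5 := core_R5 hL1n hθ hθx hθK0 hθK hx hNR0 hh hRr
  have hG1 := radius_cube_mul_le hL1n hh hR hθ hθx hx hθK
  have hG4 := radius_five_mul_le hL1n hh hR hθ hθx hx
  have hQ := Q_le (j := j) hL1n hR hNR hAQ
  have hMLle := mass_le (j := j) hL1n hR hNR hAL hAL'
  have hηle := eta_le hr hRh hθK0
  have hcap : x ≤ (151 : ℝ) ^ j / (L : ℝ) ^ (17 * j) := by rw [cap_pow_eq hL1n] at hx; exact hx
  rw [show (L : ℝ) ^ (2 * j) = ((L : ℝ) ^ j) ^ 2 by rw [← pow_mul, mul_comm]] at hC3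
  rw [show (L : ℝ) ^ (3 * j) = ((L : ℝ) ^ j) ^ 3 by rw [← pow_mul, mul_comm]] at hC5
  -- letters
  set Λ : ℝ := (L : ℝ) ^ j with hΛ
  have hΛ0 : 0 < Λ := by positivity
  have hΛR : Λ ≤ (R : ℝ) := by rw [hΛ]; exact_mod_cast hjR
  have hsθ : s = θ / (16 * (Bc * Λ)) := by rw [hs]; ring
  have hs0 : 0 ≤ s := by rw [hsθ]; positivity
  have h16 : s * (16 * (Bc * Λ)) = θ := by rw [hsθ]; exact div_mul_cancel₀ θ (by positivity)
  have hbud : s * θ / 16 = Bc * Λ * s ^ 2 := by rw [← h16]; ring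
  -- τ, M_L, η
  set τ : ℝ := s * (A_T * (4 * Λ ^ 2)) with hτ
  have hτeq : τ = θ * A_T * Λ / (4 * Bc) := by
    rw [hτ, eq_div_iff (by positivity), ← h16]; ring
  have hτ0 : 0 ≤ τ := by rw [hτ]; positivity
  have hτle : τ ≤ θ * A_T * Λ / 4 := by
    rw [hτeq]
    exact div_le_div_of_nonneg_left (by positivity) (by norm_num) hBc4
  set ML : ℝ := (A_L + A_L' * (2 * (R : ℝ) + 1 + 2 * (L : ℝ) ^ h)) * (4 * Λ ^ 2) with hML
  have hML0 : 0 ≤ ML := by rw [hML]; positivity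
  have hA₁0 : 0 ≤ 4 * (A_L + 3 * A_L') := by positivity
  set η : ℝ := (((2 * (3 : ℕ) * (r + 1) + 2 : ℕ) : ℝ) ^ 2 / 4) * θK with hη
  have hη0 : 0 ≤ η := by rw [hη]; positivity
  -- the guard
  have hguard : τ ≤ 1 / 4 := by
    have h17 : (L : ℝ) ^ (17 * j) = Λ * (L : ℝ) ^ (16 * j) := by rw [hΛ, ← pow_add]; ring_nf
    have hθΛ : θ * Λ ≤ (151 : ℝ) ^ j / (L : ℝ) ^ (16 * j) := by
      have h1' := mul_le_mul_of_nonneg_right (hθx.trans hcap) hΛ0.le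
      rw [h17] at h1'
      refine h1'.trans (le_of_eq ?_)
      field_simp
    calc τ ≤ θ * A_T * Λ / 4 := hτle
      _ = A_T * (θ * Λ) / 4 := by ring
      _ ≤ A_T * ((151 : ℝ) ^ j / (L : ℝ) ^ (16 * j)) / 4 := by gcongr
      _ = (A_T * (151 : ℝ) ^ j / (L : ℝ) ^ (16 * j)) / 4 := by ring
      _ ≤ 1 / 4 := by linarith only [h0]
  -- the rows in the cores' letters
  have h1' : 8832 * A_T * (4 * (A_L + 3 * A_L')) *
      ((N_R : ℝ) * (2 : ℝ) ^ p₀ * (L : ℝ) ^ m * (151 : ℝ) ^ j / (L : ℝ) ^ (11 * j)) ≤ 1 := by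
    refine le_of_eq_of_le ?_ h1; ring
  have h2' : (75648 + 864 * A_T) * (4 * (A_L + 3 * A_L')) *
      ((N_R : ℝ) ^ 3 * (4 : ℝ) ^ p₀ * (151 : ℝ) ^ j * ((L : ℝ) ^ (3 * m) / (L : ℝ) ^ (7 * j))) ≤ 1 := by
    refine le_of_eq_of_le ?_ h2; ring
  have h4' : 140256 * (4 * (A_L + 3 * A_L')) * A_T ^ 3 *
      ((N_R : ℝ) * (L : ℝ) ^ m * (22801 : ℝ) ^ j / (L : ℝ) ^ (26 * j)) ≤ 1 := by
    refine le_of_eq_of_le ?_ h4; ring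
  have h5' : 33191424 * (4 * (A_L + 3 * A_L')) * A_T *
      ((N_R : ℝ) ^ 5 * (4 : ℝ) ^ p₀ * (22801 : ℝ) ^ j * ((L : ℝ) ^ (5 * m) / (L : ℝ) ^ (17 * j))) ≤ 1 := by
    refine le_of_eq_of_le ?_ h5; ring
  -- the five budgets
  have hCQ := cQ_le (s := s) (θ := θ) hΛ0.le hQ hBQ hbud
  have hm1 := m1_le hθ hθK0 hτ0 hA₁0 hAT hR0 hMLle hτle hG1 h1'
  have hm2 := m2_le hθ hθ1 hθK0 hτ0 hη0 hA₁0 hAT hR1 hΛ0.le hΛR hMLle hτle hηle hC3 h2'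
  have hm4 := m4_le hθ hτ0 hA₁0 hAT hR0 hMLle hτle hG4 h4'
  have hm5 := m5_le hθ hτ0 hη0 hA₁0 hAT hR0 hΛ0.le hMLle hτle hηle hC5 h5'
  refine ⟨hguard, ?_⟩
  have hμ0 : 0 ≤ s * ML := mul_nonneg hs0 hML0
  refine rest_abstract_le hs0 hθ hτ0 hμ0 hCQ ?_ ?_ ?_ ?_ hbud
  · have := mul_le_mul_of_nonneg_left hm1 hs0
    refine le_trans (le_of_eq ?_) (this.trans (le_of_eq ?_)) <;> ring
  · have := mul_le_mul_of_nonneg_left hm2 hs0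
    refine le_trans (le_of_eq ?_) (this.trans (le_of_eq ?_)) <;> ring
  · have := mul_le_mul_of_nonneg_left hm4 hs0
    refine le_trans (le_of_eq ?_) (this.trans (le_of_eq ?_)) <;> ring
  · have := mul_le_mul_of_nonneg_left hm5 hs0
    refine le_trans (le_of_eq ?_) (this.trans (le_of_eq ?_)) <;> ring

end Assembly

/-! ## §3 The re-centred pairing-box lasso and (S7) conjunct 4 for any `β ≤ 49R²θ_K` -/

section Guards

variable {L j m h r R N_R : ℕ} {θ θK x p₀ : ℝ}

/-- The pairing-box lasso constant at the re-centred radius: `((2·3·r+2)²∕4)·θ_K ≤ 49R²·θ_K` for `r = 2R + L^h`, `4L^h + 4 ≤ R`. [folklore] -/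
theorem betaK_le (hr : r = 2 * R + L ^ h) (hRh : 4 * L ^ h + 4 ≤ R) (hθK0 : 0 ≤ θK) :
    (((2 * (3 : ℕ) * r + 2 : ℕ) : ℝ) ^ 2 / 4) * θK ≤ 49 * (R : ℝ) ^ 2 * θK := by
  refine mul_le_mul_of_nonneg_right ?_ hθK0
  have h1 : ((2 * (3 : ℕ) * r + 2 : ℕ) : ℝ) = 2 * (6 * (R : ℝ) + 3 * ((L ^ h : ℕ) : ℝ) + 1) := by
    rw [hr]; push_cast; ring
  have h2 : 3 * ((L ^ h : ℕ) : ℝ) + 1 ≤ (R : ℝ) := by exact_mod_cast (show 3 * L ^ h + 1 ≤ R by omega)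
  have h3 : (0 : ℝ) ≤ 3 * ((L ^ h : ℕ) : ℝ) + 1 := by positivity
  rw [h1]
  have h4 : (2 * (6 * (R : ℝ) + 3 * ((L ^ h : ℕ) : ℝ) + 1)) ^ 2 ≤ (2 * (7 * (R : ℝ))) ^ 2 := by
    apply pow_le_pow_left₀ (by positivity)
    linarith
  calc (2 * (6 * (R : ℝ) + 3 * ((L ^ h : ℕ) : ℝ) + 1)) ^ 2 / 4 ≤ (2 * (7 * (R : ℝ))) ^ 2 / 4 := by gcongr
    _ = 49 * (R : ℝ) ^ 2 := by ring

/-- ★ **CONJUNCT (4) OF (S7) FOR ANY PAIRING-BOX LASSO CONSTANT `β ≤ 49R²θ_K`** (= px7 g8's ✓`bulk_conjunct_le` with its `(6R+7)²θ_K` replaced by a hypothesis; the door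
uses `β := ((2·3·r+2)²∕4)·θ_K`, `r = 2R + L^h`, see `betaK_le`). [folklore] -/
theorem bulk_conjunct_le_of_le (hL : 1 ≤ L) (hh : h = j + m) (hθ : 0 ≤ θ) (hθx : θ ≤ x) (hθK0 : 0 ≤ θK)
    (hθK : θK ≤ (2 : ℝ) ^ p₀ * Real.sqrt ((L : ℝ)⁻¹) ^ j * θ) (hx : x ≤ (151 * (L : ℝ) ^ 2 * ((L : ℝ)⁻¹) ^ 19) ^ j)
    {N_R' : ℝ} (hNR : 1 ≤ N_R') (hR : (R : ℝ) = N_R' * (L : ℝ) ^ (2 * j + h))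
    {A_B A_B' β : ℝ} (hAB : 0 ≤ A_B) (hAB' : 0 ≤ A_B') (hβ : β ≤ 49 * (R : ℝ) ^ 2 * θK) {ε : ℝ} (hε : ε ≤ 1 / 128)
    (hbulk : 1888 * Real.sqrt 3 * (A_B + A_B') * (N_R' ^ 3 * (4 : ℝ) ^ p₀ * (L : ℝ) ^ (3 * m)) * (151 : ℝ) ^ j / (L : ℝ) ^ (7 * j) ≤ ε) :
    Real.sqrt 3 * (60 * θK ^ 2 + 6 * β * θK) / 3 * ((A_B + A_B' * (2 * (R : ℝ) + 2 * (L : ℝ) ^ h)) * (4 * ((L : ℝ) ^ j) ^ 2)) ≤ θ / 64 := by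
  have h3 : 0 ≤ Real.sqrt 3 := Real.sqrt_nonneg 3
  have hR0 : (0 : ℝ) ≤ (R : ℝ) := by positivity
  have hη : Real.sqrt 3 * (60 * θK ^ 2 + 6 * β * θK) / 3 ≤ Real.sqrt 3 * (60 * θK ^ 2 + 6 * (49 * (R : ℝ) ^ 2 * θK) * θK) / 3 := by
    have h6 : 6 * β * θK ≤ 6 * (49 * (R : ℝ) ^ 2 * θK) * θK := by nlinarith
    have := mul_le_mul_of_nonneg_left (by linarith : 60 * θK ^ 2 + 6 * β * θK ≤ 60 * θK ^ 2 + 6 * (49 * (R : ℝ) ^ 2 * θK) * θK) h3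
    linarith
  have hP0 : 0 ≤ (A_B + A_B' * (2 * (R : ℝ) + 2 * (L : ℝ) ^ h)) * (4 * ((L : ℝ) ^ j) ^ 2) := by positivity
  have hmono := mul_le_mul_of_nonneg_right hη hP0
  have hrow := bulk_row_le' hL hθ hθx hθK0 hθK hx hNR hh hR hAB hAB'
  have hsq : ((L : ℝ) ^ j) ^ 2 = (L : ℝ) ^ (2 * j) := by rw [← pow_mul, mul_comm]
  have hre : Real.sqrt 3 * (60 * θK ^ 2 + 6 * (49 * (R : ℝ) ^ 2 * θK) * θK) / 3
        * ((A_B + A_B' * (2 * (R : ℝ) + 2 * (L : ℝ) ^ h)) * (4 * ((L : ℝ) ^ j) ^ 2))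
      = Real.sqrt 3 * (60 * θK ^ 2 + 6 * (49 * (R : ℝ) ^ 2 * θK) * θK) / 3
        * (A_B + A_B' * (2 * (R : ℝ) + 2 * (L : ℝ) ^ h)) * (4 * (L : ℝ) ^ (2 * j)) := by
    rw [hsq]; ring
  rw [hre] at hmono
  have hfac : 1888 * Real.sqrt 3 * (A_B + A_B') * (N_R' ^ 3 * (4 : ℝ) ^ p₀ * (L : ℝ) ^ (3 * m)) * (151 : ℝ) ^ j / (L : ℝ) ^ (7 * j) * θ
      ≤ ε * θ := mul_le_mul_of_nonneg_right hbulk hθ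
  have hεθ : ε * θ ≤ 1 / 128 * θ := mul_le_mul_of_nonneg_right hε hθ
  linarith

end Guards

end Summit.QuantumFields.YangMills.Theorems.CovariantDischargeDoorGlueRows

end
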